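import Summits.Ventures.PercRepro.Night2LocalDQPenultA

/-!
# PercRepro — the regime `|E ∖ G| = q` with `q − 1` coloops, structure B (night-2, gen 11)

The refined layer-1 request at a covering set `S″ = B ∪ {z}` (`B ∈ ex2 S`, `z ∈ S ∖ B`) inside a shadow set
with `q − 1` coloops and a series pair (three non-coloops, `card_nonColoops_eq_three` of part A): any two of
them form a series pair (`seriesPair_of_nonColoops`), the thin covering preimages of `S″` are `S″ ∖ x` for the two
non-coloops `x ∈ S″` (`thin_preimages_subset`, `card_insert_sdiff_coloops`), a thin preimage with
`|G ∖ cl B'| = 2` has a series-pair complement equal to `G ∖ cl B'` (`thin_preimage_props`), so at most one of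
them has `|G ∖ cl B'| = 2` unless `G = S` (`card_thin_card_two_le_one`), and **`L1_le_penult`**:
`L₁(S″) ≤ Φ/(q+2) + Φ/(q+3)` when `G ≠ S`.
-/

open scoped Matroid

namespace PercRepro.Shadow

open Finset PerFlat ThmH

variable {α : Type*} [DecidableEq α] {M : Matroid α} [M.Finite]

section Structure

variable {q : ℕ} {G S : Finset α}

/-- Any two distinct non-coloops of `S` form a series pair when `S` has `q − 1` coloops and `3` non-coloops
(loopless `M`): the third non-coloop is a nonloop, so `S ∖ {x, y} = K ∪ {third}` has rank `q`. -/
theorem seriesPair_of_nonColoops (hl : ∀ e ∈ gr M, M.Indep {e}) (hG : G ∈ flatsQ M (q + 1))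
    (hS : S ∈ shadowAt M (q + 2) q (Uq M (q + 2) q) G) (ha : (coloops M S).card = q - 1) (hq : 1 ≤ q)
    (hT : (nonColoops M S).card = 3) {x y : α} (hx : x ∈ nonColoops M S) (hy : y ∈ nonColoops M S)
    (hxy : x ≠ y) : SeriesPair M S q x y := by
  have hSG : S ⊆ G := subset_of_mem_shadowAt hS
  have hSE : S ⊆ gr M := hSG.trans (mem_flatsQ.1 hG).1
  have hSr : rkN M S = q + 1 := rkN_eq_of_mem_shadowAt hS
  have hxS : x ∈ S := (Finset.mem_sdiff.1 hx).1
  have hyS : y ∈ S := (Finset.mem_sdiff.1 hy).1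
  refine ⟨hxS, hyS, hxy, ?_, ?_, ?_⟩
  · rw [rkN_erase_eq_of_nonColoop hxS (Finset.mem_sdiff.1 hx).2, hSr]
  · rw [rkN_erase_eq_of_nonColoop hyS (Finset.mem_sdiff.1 hy).2, hSr]
  · -- S ∖ {x, y} = coloops ∪ (nonColoops ∖ {x, y}), the latter a single nonloop
    have hrest : (nonColoops M S \ {x, y}).card = 1 := by
      have hsub : ({x, y} : Finset α) ⊆ nonColoops M S := by
        intro e he
        rw [Finset.mem_insert, Finset.mem_singleton] at he
        rcases he with rfl | rfl
        · exact hx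
        · exact hy
      have := Finset.card_sdiff_add_card_eq_card hsub
      rw [Finset.card_pair hxy] at this
      omega
    obtain ⟨t, ht⟩ := Finset.card_eq_one.1 hrest
    have htmem : t ∈ nonColoops M S \ {x, y} := ht ▸ Finset.mem_singleton_self t
    have hunion : coloops M S ∪ (nonColoops M S \ {x, y}) = S \ {x, y} := by
      ext e
      simp only [Finset.mem_union, Finset.mem_sdiff, nonColoops]
      constructor
      · rintro (he | ⟨⟨heS, -⟩, heP⟩)
        · refine ⟨coloops_subset_self S he, fun heP => ?_⟩
          rw [Finset.mem_insert, Finset.mem_singleton] at heP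
          rcases heP with rfl | rfl
          · exact (Finset.mem_sdiff.1 hx).2 he
          · exact (Finset.mem_sdiff.1 hy).2 he
        · exact ⟨heS, heP⟩
      · rintro ⟨heS, heP⟩
        by_cases hc : e ∈ coloops M S
        · exact Or.inl hc
        · exact Or.inr ⟨⟨heS, hc⟩, heP⟩
    have h := eRk_union_coloops hSE (coloops M S) (fun y hy => mem_coloops.1 hy)
      (X := nonColoops M S \ {x, y}) (Finset.sdiff_subset.trans Finset.sdiff_subset)
      (Finset.disjoint_of_subset_right Finset.sdiff_subset Finset.disjoint_sdiff)
    rw [hunion, ha, ht, Finset.coe_singleton, eRk_eq_rkN] at h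
    have htE : t ∈ gr M := hSE ((Finset.mem_sdiff.1 ((Finset.mem_sdiff.1 htmem).1)).1)
    rw [(hl t htE).eRk_eq_encard, Set.encard_singleton] at h
    have h' : rkN M (S \ {x, y}) = q - 1 + 1 := by exact_mod_cast h
    omega

open scoped Classical in
/-- **The thin covering preimages of a set `B ∪ {z}`** (`k = q − 1 = #coloops(S)`): every thin covering preimage
of `S″ = B ∪ {z}` is `S″ ∖ x` for an `x ∈ S″` that is not a coloop of `S`. -/
theorem thin_preimages_subset (hG : G ∈ flatsQ M (q + 1)) (hd : (gr M \ G).card = q)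
    (hk : kColoops M G = q - 1) (hS : S ∈ shadowAt M (q + 2) q (Uq M (q + 2) q) G)
    (ha : (coloops M S).card = q - 1) (B : Finset α) (z : α) :
    (coverPreimages M (Uq M (q + 2) q) G (insert z B)).filter (fun B' => B' ∉ lay0 M q G) ⊆
      ((insert z B) \ coloops M S).image (fun x => (insert z B).erase x) := by
  intro B' hB'
  rw [Finset.mem_filter, mem_coverPreimages] at hB'
  obtain ⟨⟨hB'm, hcov⟩, hB'0⟩ := hB'
  obtain ⟨x, hx, hxS⟩ := mem_coverSets.1 hcov
  have hB'U : B' ∈ Uq M (q + 2) q := (mem_membersIn.1 hB'm).1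
  have hxB' : x ∉ B' := notMem_of_notMem_clF hB'U (Finset.mem_sdiff.1 hx).2
  have hK : coloops M S = G.filter (fun y => y ∉ clF M (G.erase y)) :=
    coloops_eq_filter_of_card hS (by rw [ha, hk])
  have hxK : x ∉ coloops M S := by
    intro hxK
    rw [hK, Finset.mem_filter] at hxK
    exact hB'0 (mem_lay0_of_coverSets_coloop hG hd hB'm hx hxK.2)
  rw [Finset.mem_image]
  refine ⟨x, Finset.mem_sdiff.2 ⟨?_, hxK⟩, ?_⟩
  · rw [← hxS]; exact Finset.mem_insert_self _ _
  · rw [← hxS, Finset.erase_insert hxB']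

/-- `B ∪ {z}` minus the coloops of `S` has exactly two elements (`B ∈ ex2 S`, `z ∈ S ∖ B`, three non-coloops). -/
theorem card_insert_sdiff_coloops (hG : G ∈ flatsQ M (q + 1))
    (hS : S ∈ shadowAt M (q + 2) q (Uq M (q + 2) q) G) (hT : (nonColoops M S).card = 3)
    {B : Finset α} (hB : B ∈ ex2 M q G S) {z : α} (hz : z ∈ S \ B) :
    ((insert z B) \ coloops M S).card = 2 := by
  have hSG : S ⊆ G := subset_of_mem_shadowAt hS
  have hSE : S ⊆ gr M := hSG.trans (mem_flatsQ.1 hG).1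
  have hSr : rkN M S = q + 1 := rkN_eq_of_mem_shadowAt hS
  obtain ⟨-, -, hBS, -, hc⟩ := mem_ex2_unpack hB
  have hP := sdiff_mem_seriesPairs hG hS hB
  have hPT : S \ B ⊆ nonColoops M S := subset_nonColoops_of_mem_seriesPairs hSE hSr hP
  -- B ∖ K = T ∖ (S ∖ B)
  have hBK : B \ coloops M S = nonColoops M S \ (S \ B) := by
    ext e
    simp only [Finset.mem_sdiff, nonColoops]
    constructor
    · rintro ⟨heB, heK⟩
      exact ⟨⟨hBS heB, heK⟩, fun h => h.2 heB⟩
    · rintro ⟨⟨heS, heK⟩, h⟩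
      refine ⟨?_, heK⟩
      by_contra heB
      exact h ⟨heS, heB⟩
  have hBKc : (B \ coloops M S).card = 1 := by
    rw [hBK]
    have := Finset.card_sdiff_add_card_eq_card hPT
    omega
  have hzK : z ∉ coloops M S := (Finset.mem_sdiff.1 (hPT hz)).2
  have hzB : z ∉ B \ coloops M S := fun h => (Finset.mem_sdiff.1 hz).2 (Finset.mem_sdiff.1 h).1
  rw [Finset.insert_sdiff_of_notMem _ hzK, Finset.card_insert_of_notMem hzB, hBKc]

open scoped Classical in
/-- **A thin covering preimage `B'` of `S″ = B ∪ {z}` with `|G ∖ cl B'| = 2`** (`B ∈ ex2 S`, `z ∈ S ∖ B`,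
`k = q − 1 = #coloops(S)`, loopless simple `M`) is a member `⊆ S` whose complement `S ∖ B'` is a series pair of
`S` and equals `G ∖ cl B'`. -/
theorem thin_preimage_props (hs : ∀ e ∈ gr M, ∀ f ∈ gr M, e ≠ f → rkN M {e, f} = 2)
    (hl : ∀ e ∈ gr M, M.Indep {e}) (hG : G ∈ flatsQ M (q + 1)) (hd : (gr M \ G).card = q)
    (hk : kColoops M G = q - 1) (hS : S ∈ shadowAt M (q + 2) q (Uq M (q + 2) q) G)
    (ha : (coloops M S).card = q - 1) (hq : 1 ≤ q) {B : Finset α} (hB : B ∈ ex2 M q G S) {z : α}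
    (hz : z ∈ S \ B) {B' : Finset α}
    (hB' : B' ∈ (coverPreimages M (Uq M (q + 2) q) G (insert z B)).filter (fun B' => B' ∉ lay0 M q G))
    (hm : (G \ clF M B').card = 2) :
    B' ∈ membersIn M (Uq M (q + 2) q) G ∧ B' ⊆ S ∧ S \ B' ∈ seriesPairs M S q ∧ G \ clF M B' = S \ B' := by
  have hSG : S ⊆ G := subset_of_mem_shadowAt hS
  have hSE : S ⊆ gr M := hSG.trans (mem_flatsQ.1 hG).1
  have hSr : rkN M S = q + 1 := rkN_eq_of_mem_shadowAt hS
  obtain ⟨-, -, hBS, -, hcB⟩ := mem_ex2_unpack hB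
  have hP := sdiff_mem_seriesPairs hG hS hB
  have hT : (nonColoops M S).card = 3 := card_nonColoops_eq_three hs hG hS ha hq hP
  have hPT : S \ B ⊆ nonColoops M S := subset_nonColoops_of_mem_seriesPairs hSE hSr hP
  rw [Finset.mem_filter, mem_coverPreimages] at hB'
  obtain ⟨⟨hB'm, hcov⟩, hB'0⟩ := hB'
  obtain ⟨x, hx, hxS⟩ := mem_coverSets.1 hcov
  have hB'U : B' ∈ Uq M (q + 2) q := (mem_membersIn.1 hB'm).1
  have hxB' : x ∉ B' := notMem_of_notMem_clF hB'U (Finset.mem_sdiff.1 hx).2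
  have hK : coloops M S = G.filter (fun y => y ∉ clF M (G.erase y)) :=
    coloops_eq_filter_of_card hS (by rw [ha, hk])
  have hxK : x ∉ coloops M S := by
    intro hxK
    rw [hK, Finset.mem_filter] at hxK
    exact hB'0 (mem_lay0_of_coverSets_coloop hG hd hB'm hx hxK.2)
  have hzS : z ∈ S := (Finset.mem_sdiff.1 hz).1
  have hS''S : insert z B ⊆ S := Finset.insert_subset hzS hBS
  have hB'S'' : B' ⊆ insert z B := by rw [← hxS]; exact Finset.subset_insert _ _
  have hB'S : B' ⊆ S := hB'S''.trans hS''S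
  have hxS'' : x ∈ insert z B := by rw [← hxS]; exact Finset.mem_insert_self _ _
  have hxSm : x ∈ S := hS''S hxS''
  have hxT : x ∈ nonColoops M S := Finset.mem_sdiff.2 ⟨hxSm, hxK⟩
  -- the other element z' of S ∖ B
  have hrest : ((S \ B).erase z).card = 1 := by
    rw [Finset.card_erase_of_mem hz, hcB]
  obtain ⟨z', hz'⟩ := Finset.card_eq_one.1 hrest
  have hz'mem : z' ∈ (S \ B).erase z := hz' ▸ Finset.mem_singleton_self z'
  have hz'S : z' ∈ S := (Finset.mem_sdiff.1 (Finset.mem_erase.1 hz'mem).2).1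
  have hz'B : z' ∉ B := (Finset.mem_sdiff.1 (Finset.mem_erase.1 hz'mem).2).2
  have hz'z : z' ≠ z := (Finset.mem_erase.1 hz'mem).1
  have hz'T : z' ∈ nonColoops M S := hPT (Finset.mem_erase.1 hz'mem).2
  have hz'S'' : z' ∉ insert z B := by
    rw [Finset.mem_insert]
    rintro (h | h)
    · exact hz'z h
    · exact hz'B h
  have hxz' : x ≠ z' := fun h => hz'S'' (h ▸ hxS'')
  -- S ∖ B' = {x, z'}
  have hcompl : S \ B' = {x, z'} := by
    ext e
    rw [Finset.mem_sdiff, Finset.mem_insert, Finset.mem_singleton]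
    constructor
    · rintro ⟨heS, heB'⟩
      by_cases hex : e = x
      · exact Or.inl hex
      · right
        have he'' : e ∉ insert z B := by
          intro h
          have : e ∈ B' := by
            rw [← hxS] at h
            rw [Finset.mem_insert] at h
            rcases h with h | h
            · exact absurd h hex
            · exact h
          exact heB' this
        have : e ∈ (S \ B).erase z := by
          rw [Finset.mem_erase, Finset.mem_sdiff]
          refine ⟨fun h => he'' (h ▸ Finset.mem_insert_self _ _), heS, fun h => he'' (Finset.mem_insert_of_mem h)⟩
        rw [hz', Finset.mem_singleton] at this
        exact this
    · rintro (rfl | rfl)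
      · exact ⟨hxSm, hxB'⟩
      · exact ⟨hz'S, fun h => hz'S'' (hB'S'' h)⟩
  have hser : SeriesPair M S q x z' := seriesPair_of_nonColoops hl hG hS ha hq hT hxT hz'T hxz'
  refine ⟨hB'm, hB'S, ?_, ?_⟩
  · unfold seriesPairs
    rw [Finset.mem_filter, Finset.mem_powersetCard, hcompl]
    refine ⟨⟨?_, Finset.card_pair hxz'⟩, ?_⟩
    · intro e he
      rw [Finset.mem_insert, Finset.mem_singleton] at he
      rcases he with rfl | rfl
      · exact hxSm
      · exact hz'S
    · intro a ha' b hb hab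
      rw [Finset.mem_insert, Finset.mem_singleton] at ha' hb
      rcases ha' with rfl | rfl <;> rcases hb with rfl | rfl
      · exact absurd rfl hab
      · exact hser
      · exact hser.symm
      · exact absurd rfl hab
  · -- G ∖ cl B' = {x, z'}
    have hz'cl : z' ∉ clF M B' := by
      intro hcl
      -- insert z' B' = S ∖ x has rank q + 1, but z' ∈ cl B' keeps the rank q
      have hins : insert z' B' = S.erase x := by
        ext e
        rw [Finset.mem_insert, Finset.mem_erase]
        constructor
        · rintro (rfl | h)
          · exact ⟨hxz'.symm, hz'S⟩
          · exact ⟨fun hex => hxB' (hex ▸ h), hB'S h⟩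
        · rintro ⟨hex, heS⟩
          by_cases heB' : e ∈ B'
          · exact Or.inr heB'
          · left
            have : e ∈ S \ B' := Finset.mem_sdiff.2 ⟨heS, heB'⟩
            rw [hcompl, Finset.mem_insert, Finset.mem_singleton] at this
            rcases this with h | h
            · exact absurd h hex
            · exact h
      have hcl' : z' ∈ M.closure ((B' : Finset α) : Set α) := by rw [← coe_clF]; exact_mod_cast hcl
      have h1 : M.eRk (insert z' ((B' : Finset α) : Set α)) = M.eRk ((B' : Finset α) : Set α) := by
        rw [← Matroid.eRk_insert_closure_eq, Set.insert_eq_of_mem hcl', Matroid.eRk_closure_eq]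
      rw [← Finset.coe_insert, hins, eRk_eq_rkN, eRk_eq_rkN,
        rkN_erase_eq_of_nonColoop hxSm hxK, hSr] at h1
      have hrB' : rkN M B' = q := by
        have := (mem_Uq.1 hB'U).2.1
        rw [eRk_eq_rkN] at this
        exact_mod_cast this
      rw [hrB'] at h1
      have : q + 1 = q := by exact_mod_cast h1
      omega
    have hsub : S \ B' ⊆ G \ clF M B' := by
      rw [hcompl]
      intro e he
      rw [Finset.mem_insert, Finset.mem_singleton] at he
      rcases he with rfl | rfl
      · exact hx
      · exact Finset.mem_sdiff.2 ⟨hSG hz'S, hz'cl⟩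
    symm
    apply Finset.eq_of_subset_of_card_le hsub
    rw [hm, hcompl, Finset.card_pair hxz']

open scoped Classical in
/-- At most one thin covering preimage of `B ∪ {z}` has `|G ∖ cl B'| = 2` when `G ≠ S`. -/
theorem card_thin_card_two_le_one (hs : ∀ e ∈ gr M, ∀ f ∈ gr M, e ≠ f → rkN M {e, f} = 2)
    (hl : ∀ e ∈ gr M, M.Indep {e}) (hG : G ∈ flatsQ M (q + 1)) (hd : (gr M \ G).card = q)
    (hk : kColoops M G = q - 1) (hS : S ∈ shadowAt M (q + 2) q (Uq M (q + 2) q) G)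
    (ha : (coloops M S).card = q - 1) (hq : 1 ≤ q) (hGS : G ≠ S) {B : Finset α} (hB : B ∈ ex2 M q G S)
    {z : α} (hz : z ∈ S \ B) :
    (((coverPreimages M (Uq M (q + 2) q) G (insert z B)).filter (fun B' => B' ∉ lay0 M q G)).filter
      (fun B' => (G \ clF M B').card = 2)).card ≤ 1 := by
  rw [Finset.card_le_one]
  intro B₁ hB₁ B₂ hB₂
  rw [Finset.mem_filter] at hB₁ hB₂
  by_contra hne
  obtain ⟨h1m, h1S, h1P, h1e⟩ := thin_preimage_props hs hl hG hd hk hS ha hq hB hz hB₁.1 hB₁.2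
  obtain ⟨h2m, h2S, h2P, h2e⟩ := thin_preimage_props hs hl hG hd hk hS ha hq hB hz hB₂.1 hB₂.2
  exact hGS (eq_of_two_members_card_two hq hs hl hG hd hk hS ha h1m h2m h1S h2S h1P h2P hne h1e h2e)

open scoped Classical in
/-- **The refined layer-1 request at a covering set** (`k = q − 1`, `G ≠ S`): `L₁(B ∪ {z}) ≤ Φ/(q+2) + Φ/(q+3)`
— at most two thin preimages, at most one of them with `|G ∖ cl B'| = 2`. -/
theorem L1_le_penult (hs : ∀ e ∈ gr M, ∀ f ∈ gr M, e ≠ f → rkN M {e, f} = 2)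
    (hl : ∀ e ∈ gr M, M.Indep {e}) (hG : G ∈ flatsQ M (q + 1)) (hd : (gr M \ G).card = q)
    (hk : kColoops M G = q - 1) (hS : S ∈ shadowAt M (q + 2) q (Uq M (q + 2) q) G)
    (ha : (coloops M S).card = q - 1) (hq : 1 ≤ q) (hGS : G ≠ S) {B : Finset α} (hB : B ∈ ex2 M q G S)
    {z : α} (hz : z ∈ S \ B) :
    L1 M q G (insert z B) ≤ phiQ q / ((q : ℚ) + 2) + phiQ q / ((q : ℚ) + 3) := by
  have hSG : S ⊆ G := subset_of_mem_shadowAt hS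
  have hSE : S ⊆ gr M := hSG.trans (mem_flatsQ.1 hG).1
  have hP := sdiff_mem_seriesPairs hG hS hB
  have hT : (nonColoops M S).card = 3 := card_nonColoops_eq_three hs hG hS ha hq hP
  set F := (coverPreimages M (Uq M (q + 2) q) G (insert z B)).filter (fun B' => B' ∉ lay0 M q G) with hF
  have hphi : 0 < phiQ q := phiQ_pos q
  have hq2 : (0 : ℚ) < (q : ℚ) + 2 := by positivity
  have hq3 : (0 : ℚ) < (q : ℚ) + 3 := by positivity
  have hab : phiQ q / ((q : ℚ) + 3) ≤ phiQ q / ((q : ℚ) + 2) :=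
    div_le_div_of_nonneg_left hphi.le hq2 (by linarith)
  have hb0 : 0 ≤ phiQ q / ((q : ℚ) + 3) := div_nonneg hphi.le hq3.le
  -- pointwise bound
  have hpt : ∀ B' ∈ F, req M q B' ≤
      if (G \ clF M B').card = 2 then phiQ q / ((q : ℚ) + 2) else phiQ q / ((q : ℚ) + 3) := by
    intro B' hB'
    rw [hF, Finset.mem_filter, mem_coverPreimages] at hB'
    obtain ⟨⟨hB'm, -⟩, hB'0⟩ := hB'
    have hm2 : 2 ≤ (G \ clF M B').card := two_le_card_sdiff_of_not_lay0 hG hd.le hB'm hB'0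
    have hreq : req M q B' = phiQ q / (((G \ clF M B').card : ℚ) + (q : ℚ)) := by
      unfold req
      rw [card_compl_clF_add hG (mem_membersIn.1 hB'm).2, hd]
      push_cast
      rfl
    rw [hreq]
    split_ifs with h2
    · rw [h2]; push_cast; exact le_of_eq (by ring_nf)
    · have h3 : (3 : ℚ) ≤ ((G \ clF M B').card : ℚ) := by
        have : 3 ≤ (G \ clF M B').card := by omega
        exact_mod_cast this
      apply div_le_div_of_nonneg_left hphi.le hq3
      linarith
  have hsum : L1 M q G (insert z B) ≤ ∑ B' ∈ F,
      (if (G \ clF M B').card = 2 then phiQ q / ((q : ℚ) + 2) else phiQ q / ((q : ℚ) + 3)) := by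
    unfold L1
    exact Finset.sum_le_sum hpt
  rw [Finset.sum_ite, Finset.sum_const, Finset.sum_const, nsmul_eq_mul, nsmul_eq_mul] at hsum
  -- the counts
  have hA : (F.filter (fun B' => (G \ clF M B').card = 2)).card ≤ 1 :=
    card_thin_card_two_le_one hs hl hG hd hk hS ha hq hGS hB hz
  have hFc : F.card ≤ 2 := by
    calc F.card ≤ (((insert z B) \ coloops M S).image (fun x => (insert z B).erase x)).card :=
          Finset.card_le_card (thin_preimages_subset hG hd hk hS ha B z)
      _ ≤ ((insert z B) \ coloops M S).card := Finset.card_image_le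
      _ = 2 := card_insert_sdiff_coloops hG hS hT hB hz
  have hAC : (F.filter (fun B' => (G \ clF M B').card = 2)).card +
      (F.filter (fun B' => ¬ (G \ clF M B').card = 2)).card = F.card :=
    Finset.card_filter_add_card_filter_not _
  have hA' : ((F.filter (fun B' => (G \ clF M B').card = 2)).card : ℚ) ≤ 1 := by exact_mod_cast hA
  have hA0 : (0 : ℚ) ≤ ((F.filter (fun B' => (G \ clF M B').card = 2)).card : ℚ) := Nat.cast_nonneg _
  have hC0 : (0 : ℚ) ≤ ((F.filter (fun B' => ¬ (G \ clF M B').card = 2)).card : ℚ) := Nat.cast_nonneg _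
  have hsum2 : ((F.filter (fun B' => (G \ clF M B').card = 2)).card : ℚ) +
      ((F.filter (fun B' => ¬ (G \ clF M B').card = 2)).card : ℚ) ≤ 2 := by
    have : (F.filter (fun B' => (G \ clF M B').card = 2)).card +
        (F.filter (fun B' => ¬ (G \ clF M B').card = 2)).card ≤ 2 := by omega
    exact_mod_cast this
  refine hsum.trans ?_
  nlinarith [mul_nonneg (sub_nonneg.2 hA') (sub_nonneg.2 hab), mul_nonneg (sub_nonneg.2 hsum2) hb0,
    mul_nonneg hA0 (sub_nonneg.2 hab), mul_nonneg hC0 hb0]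

end Structure

end PercRepro.Shadow
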